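import Literature.AnabelianGeometry.SemiGraphs.ArithTotalEstrangementOpenKernelObstruction
import Literature.AnabelianGeometry.SemiGraphs.ArithBranchActionConsequences
import Literature.AnabelianGeometry.SemiGraphs.ArithEdgeLikeTwoHosts
import Literature.AnabelianGeometry.SemiGraphs.ArithTemperedGroupOfOuterAction
import Literature.AnabelianGeometry.SemiGraphs.TemperedCompactInVerticialFinite
import Literature.AnabelianGeometry.SemiGraphs.TemperedReconstructionR2bProofs
import Literature.AnabelianGeometry.SemiGraphs.TemperoidsResProofs
import Literature.AnabelianGeometry.SemiGraphs.TemperedReconstructionR3cProofs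
import Literature.AnabelianGeometry.SemiGraphs.IwahoriComplementFactors
import HarnessLib

/-!
# [SemiAnbd] Def 5.3 (ii) / Thm 5.4 at the Iwahori loop graph: total arithmetic estrangement is
# IMPOSSIBLE under branch transport — for EVERY outer action (surrogate-carrier obstruction)

Mochizuki, *Semi-graphs of anabelioids*, Publ. RIMS **42** (2006) 221–322, §5: Def. 5.3 (ii) p. 65
("for every vertex `v` to which some branch `b` of `e` abuts and every `g ∈ Π^temp_{𝔊,v}`, the
intersection in `Π^temp_{𝔊,v}` of `Π^temp_{𝔊,b}` with any subgroup of the form `g · Π^temp_{𝔊,b'} · g⁻¹`,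
where … `b' ≠ b` …, fails to be arithmetically ample"), Thm. 5.4 p. 66 (hypothesis "totally
arithmetically estranged"; frame: Def. 5.1 (i) — the arithmetic action transports the decomposition
groups, "do not switch the branches"), Ex. 5.6 p. 67. [cite: MochizukiSemiAnbd2006, Def 5.3 (ii), p. 65]

PROOF-ONLY file (abc-iut cell, layer L3, T54 board, row «HEST-IMPOSSIBLE@Iw_p» = abc-iut-L3-lead β69 (ii);
seat abc-iut-f-177 gen 8; SHAPES memo `HOME/staging/f/f-177/g8/T54-CARRIER-SHAPES.md`).  No definition,
no new named fact; every input is consumed BY NAME.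

THE RESULT.  At abc-iut-w5-d236's Thm-3.7 witness WITH an edge, `𝓛 = IwahoriWitness.loopGraph p` (one
vertex with `P = ℤ_p ⋊ (1+pℤ_p)`, one geometrically estranged loop whose two branch subgroups are the
complements `T₀`, `T₁` of the translation subgroup), the hypothesis `hest : IsTotallyArithEstranged …` of
the T54 capstones (read, as there, on the commensurator-produced decomposition data
`decompositionDataOfChart Rc (toOuterSemidirectProduct ρ')` of `π₁^temp(𝓛) ⋊^out Π_A`) is FALSE for EVERY
`Π_A`, EVERY outer action `ρ' : Π_A → Out(π₁^temp 𝓛)` with base action `baseAct`, and EVERY choice of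
§3 representatives `Rc`, as soon as the frame's own DESIGN binder `hBR` (branch transport: Prop. 3.6 (iv)
at `ρ_𝔾(a)` / Def. 5.1 (i), verbatim the binder of abc-iut-w4-d029's capstone v8 p449794) and
`noSwitchBase` hold — `IwahoriWitness.not_isTotallyArithEstranged_loopGraph_of_branchTransport`.  The
open-kernel obstruction (abc-iut-w4-d040 `…_of_isOpen_ker`, p444375/p444753) and the split case
(abc-iut-w6-d072) are the special cases `ρ' = 1` on an open subgroup; here NO condition on `ρ'` remains.

MECHANISM (the SIZE of the vertex group; the `ℤ_p`-algebra is file (A) `IwahoriComplementFactors.lean`).  In `P`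
every conjugate of `T_c = {(c s, s)}` is a `T_{c'}` with `c' ≡ c (mod p)` and conversely (`Iw.map_conj_range_bHom`,
`Iw.exists_map_conj_range_bHom_eq_of_sub_eq`), and two complements of DIFFERENT classes are complementary
FACTORS: `T_c · T_d = P` whenever `c − d ∈ ℤ_pˣ` (`Iw.exists_mul_eq_of_isUnit_sub`).  By
`hBR` + Prop. 3.2 (`exists_conj_of_isVerticialHom`) every `a ∈ Π_A` has a representative of `ρ'(a)`
STABILISING the vertex representative `Π_v` together with ONE branch representative; two such
representatives (for `b₀` and for `b₁`) differ by conjugation by an element of `N(Π_v) = Π_v`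
(Thm. 3.7 (ii), `commensurator_eq_of_mem_verticialSubgroups`), i.e. by some `ψ(q)`, `q ∈ P`; the
representatives `Rc.Hb bᵢ ≤ Rc.Hv v` are `ψ(T_{cᵢ})` for ONE verticial `ψ`
(`exists_branch_presentation_of_edgeLike_le_verticialAt` at the finite graph `𝓛`).  If `c₀ − c₁` is a
unit, factor `q = t₁ t₀` and re-align: ONE representative of `ρ'(a)` stabilises `Π_v`, `Π_{b₀}`, `Π_{b₁}`,
so `Π^temp_{𝔊,b₀} ∩ Π^temp_{𝔊,b₁}` surjects onto `Π_A` — Def. 5.3 (ii) clause (A) fails at `g = 1`; if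
`c₀ ≡ c₁ (mod p)` (the degenerate / same-class choices, cf. abc-iut-w4-d089 p446672) then
`Π_{b₁} = ψ(x)·Π_{b₀}·ψ(x)⁻¹` and clause (A) fails at `g = ι(ψ x)⁻¹`.  No continuity, no kernel
condition and no compactness of `Π_A` is used.

HONEST SCOPE.  A statement about OUR surrogate carrier family (the Iwahori witness), labelled
«surrogate-carrier obstruction»: the T54 binders `{hBR, noSwitchBase, hest}` are jointly uninhabited at
`loopGraph p`; a contentful `hest` needs a vertex group in which the two branch classes are NOT
complementary factors (print's Ex. 5.6: free/surface-type `Δ_v`, procyclic inertia, Lem. 5.5 + Frobenius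
weights — the cell's GAP «Ex 5.6 genuine carrier»).  Nothing here asserts or denies anything about
print's Ex. 5.6 or about [IUTchIII] Cor. 3.12; typed ≠ proved elsewhere.
-/

noncomputable section

namespace Literature.AnabelianGeometry.SemiGraphs

open Literature.AnabelianGeometry.EtaleTheta CategoryTheory Topology

/-! ### 1. Subgroup bookkeeping (private): conjugation and stabilisation -/

section Bookkeeping

variable {P : Type*} [Group P] {G : Type*} [Group G]

/-- `S.map (φ ψ) = (S.map ψ).map φ` for automorphisms (`(φ * ψ) x = φ (ψ x)`). [folklore] -/
private theorem map_mulAut_mul (φ ψ : MulAut G) (S : Subgroup G) :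
    S.map (φ * ψ).toMonoidHom = (S.map ψ.toMonoidHom).map φ.toMonoidHom := by
  rw [Subgroup.map_map]; rfl

/-- Conjugating by an element of `S` fixes `S`. [folklore] -/
private theorem map_conj_of_mem {S : Subgroup G} {h : G} (hh : h ∈ S) :
    S.map (MulAut.conj h).toMonoidHom = S := by
  ext y
  simp only [Subgroup.mem_map, MulEquiv.coe_toMonoidHom, MulAut.conj_apply]
  constructor
  · rintro ⟨z, hz, rfl⟩
    exact S.mul_mem (S.mul_mem hh hz) (S.inv_mem hh)
  · intro hy
    exact ⟨h⁻¹ * y * h, S.mul_mem (S.mul_mem (S.inv_mem hh) hy) hh, by group⟩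

/-- If `χ = conj x ∘ ψ` pointwise then `(S.map ψ).map (conj x) = S.map χ`. [folklore] -/
private theorem map_map_conj_eq_of_forall (ψ χ : P →* G) (x : G) (h : ∀ y, χ y = x * ψ y * x⁻¹)
    (S : Subgroup P) : (S.map ψ).map (MulAut.conj x).toMonoidHom = S.map χ := by
  rw [Subgroup.map_map]
  congr 1
  ext y
  simp [MulAut.conj_apply, h y]

/-- If `χ = conj x ∘ ψ` pointwise then `ψ.range.map (conj x) = χ.range`. [folklore] -/
private theorem range_map_conj_eq_of_forall (ψ χ : P →* G) (x : G) (h : ∀ y, χ y = x * ψ y * x⁻¹) :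
    ψ.range.map (MulAut.conj x).toMonoidHom = χ.range := by
  rw [MonoidHom.range_eq_map, MonoidHom.range_eq_map]
  exact map_map_conj_eq_of_forall ψ χ x h ⊤

/-- `χ (x S x⁻¹) = χ(x) χ(S) χ(x)⁻¹`. [folklore] -/
private theorem map_map_conj_hom (χ : P →* G) (x : P) (S : Subgroup P) :
    (S.map (MulAut.conj x).toMonoidHom).map χ = (S.map χ).map (MulAut.conj (χ x)).toMonoidHom := by
  rw [Subgroup.map_map, Subgroup.map_map]
  congr 1
  ext y
  simp [MulAut.conj_apply, map_mul, map_inv]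

end Bookkeeping

/-! ### 2. Chart-level inputs: Prop. 3.2 and Thm. 3.7 (ii) by name -/

namespace ProfiniteSemiGraph

universe u

variable {𝒢 : ProfiniteSemiGraph.{u}}

/-- A `π₁^temp(𝒢)`-conjugate of a verticial homomorphism is a verticial homomorphism (Prop. 3.2: the
pull-back functors of `ψ` and `γ_x ∘ ψ` are isomorphic, `BTemp.resIsoOfConj`).
[cite: MochizukiSemiAnbd2006, Prop 3.2 p.35] -/
theorem exists_isVerticialHom_conj (c : TemperedPiChart 𝒢) {v : 𝒢.graph.Vertex}
    (ψ : 𝒢.Gv v →ₜ* c.G) (hψ : IsVerticialHom c v ψ) (x : c.G) :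
    ∃ χ : 𝒢.Gv v →ₜ* c.G, IsVerticialHom c v χ ∧ ∀ y, χ y = x * ψ y * x⁻¹ := by
  haveI := c.isTopologicalGroup
  let χ : 𝒢.Gv v →ₜ* c.G :=
    { toMonoidHom := (MulAut.conj x).toMonoidHom.comp ψ.toMonoidHom
      continuous_toFun := by
        exact ((continuous_const.mul continuous_id).mul continuous_const).comp ψ.continuous }
  obtain ⟨e⟩ := hψ
  exact ⟨χ, ⟨e ≪≫ BTemp.resIsoOfConj ψ χ x (fun a => rfl)⟩, fun y => rfl⟩

/-- Two bi-continuous representatives of one outer class both STABILISING a verticial subgroup `H`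
differ by conjugation by an element of `H` (Prop. 3.2 + Thm. 3.7 (ii)).
[cite: MochizukiSemiAnbd2006, Thm 3.7 (ii), p. 40] -/
theorem exists_mem_coe_eq_conj_mul (h𝒢 : 𝒢.Thm37Hypotheses) (c : TemperedPiChart 𝒢)
    {v : 𝒢.graph.Vertex} {H : Subgroup c.G} (hH : H ∈ verticialSubgroups c v)
    (Φ₀ Φ₁ : contMulAut c.G) (hmk : TopOut.mk _ Φ₀ = TopOut.mk _ Φ₁)
    (h₀ : H.map (Φ₀ : MulAut c.G).toMonoidHom = H) (h₁ : H.map (Φ₁ : MulAut c.G).toMonoidHom = H) :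
    ∃ g ∈ H, (Φ₁ : MulAut c.G) = MulAut.conj g * (Φ₀ : MulAut c.G) := by
  obtain ⟨g, hg⟩ := exists_conj_of_mk_eq Φ₀ Φ₁ hmk
  have hΦ : (Φ₁ : MulAut c.G) = MulAut.conj g * (Φ₀ : MulAut c.G) :=
    MulEquiv.ext fun x => by rw [MulAut.mul_apply, MulAut.conj_apply]; exact hg x
  refine ⟨g, ?_, hΦ⟩
  apply mem_of_map_conj_eq_of_mem_verticialSubgroups verticialDistinct_holds h𝒢 c hH
  have := h₁
  rwa [hΦ, map_mulAut_mul, h₀] at this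

end ProfiniteSemiGraph

/-! ### 3. The obstruction at `𝓛 = loopGraph p` -/

namespace IwahoriWitness

open ProfiniteSemiGraph

variable (p : ℕ) [Fact p.Prime] (c : TemperedPiChart (loopGraph p)) {PA : Type*} [Group PA]
  (ρ' : PA →* TopOut c.G) (baseAct : PA →* Aut (loopGraph p).graph)

/-- Equal branches of `𝓛` have equal branch subgroups (any vertex, any abutment proof).
[cite: MochizukiSemiAnbd2006, Def 2.1 p.22] -/
theorem loopGraph_branchSubgroup_congr {β β' : (loopGraph p).graph.Branch} (h : β' = β)
    {v w : (loopGraph p).graph.Vertex} (h₁ : (loopGraph p).graph.abuts β' = some w)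
    (h₂ : (loopGraph p).graph.abuts β = some v) :
    (loopGraph p).branchSubgroup β' w h₁ = (loopGraph p).branchSubgroup β v h₂ := by
  subst h
  rw [loopGraph_branchSubgroup, loopGraph_branchSubgroup]

/-- The `Aut`-component of `ι(y)` has trivial outer class. [cite: MochizukiSemiAnbd2006, §0 p.5] -/
theorem mk_fst_toOuterSemidirectProduct (y : c.G) :
    TopOut.mk c.G (toOuterSemidirectProduct ρ' y).1.1 = 1 := by
  have h := (toOuterSemidirectProduct ρ' y).2
  change TopOut.mk c.G (toOuterSemidirectProduct ρ' y).1.1 = ρ' (toOuterSemidirectProduct ρ' y).1.2 at h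
  rw [h, toOuterSemidirectProduct_snd, map_one]

/-- The `Aut`-component of `ι(y)`, as an automorphism, is `conj y`. [cite: MochizukiSemiAnbd2006, §0 p.5] -/
theorem coe_fst_toOuterSemidirectProduct (y : c.G) :
    ((toOuterSemidirectProduct ρ' y).1.1 : MulAut c.G) = MulAut.conj y := rfl

section BranchTransport

variable
  (hBR : ∀ (a : PA) (b : (loopGraph p).graph.Branch) (v : (loopGraph p).graph.Vertex)
      (hb : (loopGraph p).graph.abuts b = some v) (φ : (loopGraph p).Gv v →ₜ* c.G),
      IsVerticialHom c v φ →
      ∃ Φ : contMulAut c.G, TopOut.mk _ Φ = ρ' a ∧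
        ∃ φ' : (loopGraph p).Gv ((baseAct a).hom.vertexMap v) →ₜ* c.G,
          IsVerticialHom c ((baseAct a).hom.vertexMap v) φ' ∧
          ∃ x' : c.G,
            Subgroup.map (Φ : MulAut c.G).toMonoidHom φ.toMonoidHom.range =
              Subgroup.map (MulAut.conj x').toMonoidHom φ'.toMonoidHom.range ∧
            Subgroup.map (Φ : MulAut c.G).toMonoidHom
                (Subgroup.map φ.toMonoidHom ((loopGraph p).branchSubgroup b v hb)) =
              Subgroup.map (MulAut.conj x').toMonoidHom
                (Subgroup.map φ'.toMonoidHom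
                  ((loopGraph p).branchSubgroup ((baseAct a).hom.branchMap b)
                    ((baseAct a).hom.vertexMap v) ((baseAct a).hom.abuts_branchMap b v hb))))
  (noSwitchBase : NoBranchSwitching (loopGraph p).graph.edgeOf
      (fun (a : PA) (b : (loopGraph p).graph.Branch) => (baseAct a).hom.branchMap b))

include hBR noSwitchBase

/-- **Stabilising lifts from branch transport.**  Under `hBR` + `noSwitchBase`, for every `a ∈ Π_A`,
every branch `β` of `𝓛` and every verticial `χ : P → π₁^temp(𝓛)` there is a representative `Φ` of
`ρ'(a)` with `Φ(χ P) = χ P` and `Φ(χ Π_β) = χ Π_β` (Prop. 3.6 (iv) transport read back through Prop. 3.2: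
the transported verticial homomorphism is `γ_z ∘ χ`, so `γ_{(x'z)⁻¹} ∘ Φ` stabilises both).
[cite: MochizukiSemiAnbd2006, Prop 3.6 (iv), p. 39] -/
theorem exists_stabilizing_lift (a : PA) (β : (loopGraph p).graph.Branch)
    (v : (loopGraph p).graph.Vertex) (hβ : (loopGraph p).graph.abuts β = some v)
    (χ : (loopGraph p).Gv v →ₜ* c.G) (hχ : IsVerticialHom c v χ) :
    ∃ Φ : contMulAut c.G, TopOut.mk _ Φ = ρ' a ∧
      (χ.toMonoidHom.range).map (Φ : MulAut c.G).toMonoidHom = χ.toMonoidHom.range ∧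
      (((loopGraph p).branchSubgroup β v hβ).map χ.toMonoidHom).map (Φ : MulAut c.G).toMonoidHom =
        ((loopGraph p).branchSubgroup β v hβ).map χ.toMonoidHom := by
  haveI := c.isTopologicalGroup
  haveI : Subsingleton (loopGraph p).graph.Edge := show Subsingleton (ULift (Fin 1)) from inferInstance
  obtain ⟨Φ, hΦ, φ', hφ', x', h1, h2⟩ := hBR a β v hβ χ hχ
  -- no branch switching: the unique edge is fixed, hence so is `β`
  have hββ : (baseAct a).hom.branchMap β = β := noSwitchBase a β (Subsingleton.elim _ _)
  -- `φ'` is verticial at the (unique) vertex `v`; Prop. 3.2: `φ' = γ_z ∘ χ`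
  have hφ'v : IsVerticialHom c v φ' := hφ'
  obtain ⟨z, hz⟩ := exists_conj_of_isVerticialHom c χ φ' hχ hφ'v
  have hr : φ'.toMonoidHom.range = (χ.toMonoidHom.range).map (MulAut.conj z).toMonoidHom :=
    (range_map_conj_eq_of_forall χ.toMonoidHom φ'.toMonoidHom z (fun y => (hz y).symm)).symm
  have hb : Subgroup.map φ'.toMonoidHom ((loopGraph p).branchSubgroup ((baseAct a).hom.branchMap β)
        ((baseAct a).hom.vertexMap v) ((baseAct a).hom.abuts_branchMap β v hβ)) =
      (((loopGraph p).branchSubgroup β v hβ).map χ.toMonoidHom).map (MulAut.conj z).toMonoidHom := by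
    rw [loopGraph_branchSubgroup_congr p hββ _ hβ]
    exact (map_map_conj_eq_of_forall χ.toMonoidHom φ'.toMonoidHom z (fun y => (hz y).symm) _).symm
  rw [hr] at h1
  rw [hb] at h2
  -- the re-aligned representative `γ_{(x' z)⁻¹} ∘ Φ`
  refine ⟨(toOuterSemidirectProduct ρ' (x' * z)⁻¹).1.1 * Φ, ?_, ?_, ?_⟩
  · rw [map_mul, mk_fst_toOuterSemidirectProduct, one_mul, hΦ]
  · rw [Subgroup.coe_mul, map_mulAut_mul, h1, coe_fst_toOuterSemidirectProduct, ← map_mulAut_mul,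
      ← map_mulAut_mul, ← map_mul, ← map_mul, mul_assoc, inv_mul_cancel, map_one]
    ext y; simp
  · rw [Subgroup.coe_mul, map_mulAut_mul, h2, coe_fst_toOuterSemidirectProduct, ← map_mulAut_mul,
      ← map_mulAut_mul, ← map_mul, ← map_mul, mul_assoc, inv_mul_cancel, map_one]
    ext y; simp

/-- **[SemiAnbd] Def 5.3 (ii) FAILS at the Iwahori loop graph for EVERY outer action under branch
transport** («surrogate-carrier obstruction»): for every `Π_A`, every `ρ' : Π_A → Out(π₁^temp 𝓛)` with base
action `baseAct` satisfying `hBR` (Prop. 3.6 (iv) transport of branch groups) and `noSwitchBase`, and every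
choice `Rc` of §3 representatives, the commensurator-produced decomposition data of `π₁^temp(𝓛) ⋊^out Π_A`
are NOT totally arithmetically estranged.  Mechanism: the two branch classes of `P = ℤ_p ⋊ (1+pℤ_p)` are
complementary factors (`Iw.exists_mul_eq_of_isUnit_sub`), so the `b₀`- and `b₁`-stabilising lifts
re-align and `Π^temp_{𝔊,b₀} ∩ g·Π^temp_{𝔊,b₁}·g⁻¹` surjects onto `Π_A`; Def. 5.3 (ii) clause (A) dies.
The T54 binders `{hBR, noSwitchBase, hest}` are therefore jointly uninhabited at `loopGraph p`.
[cite: MochizukiSemiAnbd2006, Def 5.3 (ii), p. 65] -/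
theorem not_isTotallyArithEstranged_loopGraph_of_branchTransport [TopologicalSpace PA]
    (Rc : ChartRepresentatives c) :
    ¬ IsTotallyArithEstranged (decompositionDataOfChart Rc (toOuterSemidirectProduct ρ'))
      (outerSemidirectProductSnd ρ') := by
  haveI := c.isTopologicalGroup
  intro hest
  -- the edge, its two branches `b₀ ≠ b₁`, the vertex
  obtain ⟨b₀, b₁, hne, -, -, -⟩ := (loopGraph p).graph.two_branches (ULift.up (0 : Fin 1))
  haveI : Subsingleton (loopGraph p).graph.Vertex := show Subsingleton PUnit from inferInstance
  haveI : Finite (loopGraph p).graph.Vertex := show Finite PUnit from inferInstance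
  haveI : Finite (loopGraph p).graph.Edge := show Finite (ULift (Fin 1)) from inferInstance
  obtain ⟨v, hb₀⟩ := Option.isSome_iff_exists.mp ((loopGraph_isGraph p).abuts_isSome b₀)
  obtain ⟨v₁, hb₁⟩ := Option.isSome_iff_exists.mp ((loopGraph_isGraph p).abuts_isSome b₁)
  rw [Subsingleton.elim v₁ v] at hb₁
  have h37 := loopGraph_thm37Hypotheses p
  have hG := loopGraph_isGraph p
  have hCV : CompactInVerticialAt (loopGraph p) := compactInVerticialAt_of_finiteGraph
  -- a verticial `ψ` with `Rc.Hv v = ψ(P)` and the presentations of the two branch representatives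
  have hHv := Rc.Hv_mem v
  obtain ⟨ψ, hψ, -⟩ := Rc.Hv_mem v
  obtain ⟨β₀, hβ₀, x₀, -, hH₀, hK₀⟩ := exists_branch_presentation_of_edgeLike_le_verticialAt hCV h37 hG c
    (Rc.Hb_mem b₀) hHv (Rc.Hb_le b₀ v hb₀) ψ hψ
  obtain ⟨β₁, hβ₁, x₁, -, hH₁, hK₁⟩ := exists_branch_presentation_of_edgeLike_le_verticialAt hCV h37 hG c
    (Rc.Hb_mem b₁) hHv (Rc.Hb_le b₁ v hb₁) ψ hψ
  obtain ⟨χ₀, hχ₀, hχ₀eq⟩ := exists_isVerticialHom_conj c ψ hψ x₀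
  obtain ⟨χ₁, hχ₁, hχ₁eq⟩ := exists_isVerticialHom_conj c ψ hψ x₁
  have hHχ₀ : Rc.Hv v = χ₀.toMonoidHom.range := by
    rw [hH₀]; exact range_map_conj_eq_of_forall ψ.toMonoidHom χ₀.toMonoidHom x₀ hχ₀eq
  have hHχ₁ : Rc.Hv v = χ₁.toMonoidHom.range := by
    rw [hH₁]; exact range_map_conj_eq_of_forall ψ.toMonoidHom χ₁.toMonoidHom x₁ hχ₁eq
  have hKχ₀ : Rc.Hb b₀ = ((loopGraph p).branchSubgroup β₀ v hβ₀).map χ₀.toMonoidHom := by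
    rw [hK₀]; exact map_map_conj_eq_of_forall ψ.toMonoidHom χ₀.toMonoidHom x₀ hχ₀eq _
  have hKχ₁ : Rc.Hb b₁ = ((loopGraph p).branchSubgroup β₁ v hβ₁).map χ₁.toMonoidHom := by
    rw [hK₁]; exact map_map_conj_eq_of_forall ψ.toMonoidHom χ₁.toMonoidHom x₁ hχ₁eq _
  -- `χ₁ = γ_g ∘ χ₀` with `g ∈ N(χ₀ P) = χ₀(P)`, i.e. `g = χ₀ q`
  obtain ⟨g, hg⟩ := exists_conj_of_isVerticialHom c χ₀ χ₁ hχ₀ hχ₁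
  have hgH : (Rc.Hv v).map (MulAut.conj g).toMonoidHom = Rc.Hv v := by
    conv_lhs => rw [hHχ₀]
    rw [hHχ₁]
    exact range_map_conj_eq_of_forall χ₀.toMonoidHom χ₁.toMonoidHom g (fun y => (hg y).symm)
  have hgmem : g ∈ Rc.Hv v :=
    mem_of_map_conj_eq_of_mem_verticialSubgroups verticialDistinct_holds h37 c hHv hgH
  rw [hHχ₀] at hgmem
  obtain ⟨q, hq⟩ := hgmem
  -- the second branch representative through `χ₀`: `Rc.Hb b₁ = χ₀ (q T_{c₁} q⁻¹) = χ₀ (T_{c₁''})`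
  have hT : ((loopGraph p).branchSubgroup β₁ v hβ₁).map (MulAut.conj q).toMonoidHom =
      (Iw.bHom (w p q.s * coeff p β₁ - (p : ℤ_[p]) * q.a)).toMonoidHom.range :=
    Iw.map_conj_range_bHom q (coeff p β₁)
  have hKχ₁' : Rc.Hb b₁ =
      ((Iw.bHom (w p q.s * coeff p β₁ - (p : ℤ_[p]) * q.a)).toMonoidHom.range).map χ₀.toMonoidHom := by
    rw [← hT, map_map_conj_hom, hq,
      map_map_conj_eq_of_forall χ₀.toMonoidHom χ₁.toMonoidHom g (fun y => (hg y).symm), ← hKχ₁]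
  -- DICHOTOMY on the two coefficients
  by_cases hc : coeff p β₀ = coeff p β₁
  · /- same class: `Rc.Hb b₁ = γ_{χ₀ y}(Rc.Hb b₀)`; clause (A) at `gι := ι(χ₀ y)⁻¹` -/
    have he : w p q.s * coeff p β₁ - (p : ℤ_[p]) * q.a - coeff p β₀ =
        (p : ℤ_[p]) * (q.s * coeff p β₁ - q.a) := by
      rw [hc]; exact conj_label_sub_eq (coeff p β₁) q
    have hx : ∃ y : (loopGraph p).Gv v,
        ((loopGraph p).branchSubgroup β₀ v hβ₀).map (MulAut.conj y).toMonoidHom =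
          (Iw.bHom (w p q.s * coeff p β₁ - (p : ℤ_[p]) * q.a)).toMonoidHom.range :=
      Iw.exists_map_conj_range_bHom_eq_of_sub_eq (p := p) he
    obtain ⟨y, hy⟩ := hx
    have hK₁₀ : Rc.Hb b₁ = (Rc.Hb b₀).map (MulAut.conj (χ₀.toMonoidHom y)).toMonoidHom := by
      rw [hKχ₁', ← hy, map_map_conj_hom, ← hKχ₀]
    have hymem : χ₀.toMonoidHom y ∈ Rc.Hv v := by rw [hHχ₀]; exact ⟨y, rfl⟩
    set gι : outerSemidirectProduct ρ' := (toOuterSemidirectProduct ρ' (χ₀.toMonoidHom y))⁻¹ with hgι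
    have hgιv : gι ∈ arithVertGp Rc (toOuterSemidirectProduct ρ') v := by
      refine mem_arithVertGp_of_map_eq c ρ' Rc gι ?_
      rw [hgι, ← map_inv, coe_fst_toOuterSemidirectProduct]
      exact map_conj_of_mem ((Rc.Hv v).inv_mem hymem)
    refine (hest ((loopGraph p).graph.edgeOf b₀) b₀ rfl v hb₀ gι hgιv).1 b₁ hb₁ hne.symm
      (isArithAmple_of_forall_exists _ fun a => ?_)
    obtain ⟨Φ₀, hmk₀, hΦ₀H, hΦ₀K⟩ :=
      exists_stabilizing_lift p c ρ' baseAct hBR noSwitchBase a β₀ v hβ₀ χ₀ hχ₀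
    rw [← hKχ₀] at hΦ₀K
    rw [← hHχ₀] at hΦ₀H
    let γ : outerSemidirectProduct ρ' := ⟨(Φ₀, a), hmk₀⟩
    have hγ₀ : γ ∈ arithBrGp Rc (toOuterSemidirectProduct ρ') b₀ :=
      mem_arithBrGp_of_map_eq c ρ' Rc γ hb₀ hΦ₀H hΦ₀K
    refine ⟨γ, Subgroup.mem_inf.mpr ⟨hγ₀, ?_⟩, rfl⟩
    -- `γ = gι · (gι⁻¹ γ gι) · gι⁻¹` with `gι⁻¹ γ gι` stabilising `Π_v` and `Π_{b₁}`
    refine ⟨gι⁻¹ * γ * gι, ?_, by rw [MulEquiv.coe_toMonoidHom, MulAut.conj_apply]; group⟩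
    have hfst : (((gι⁻¹ * γ * gι : outerSemidirectProduct ρ') : contMulAut c.G × PA).1 : MulAut c.G) =
        MulAut.conj (χ₀.toMonoidHom y) * (Φ₀ : MulAut c.G) * MulAut.conj (χ₀.toMonoidHom y)⁻¹ := by
      rw [hgι, inv_inv, map_inv]; rfl
    refine mem_arithBrGp_of_map_eq c ρ' Rc _ hb₁ ?_ ?_
    · rw [hfst, map_mulAut_mul, map_mulAut_mul, map_conj_of_mem ((Rc.Hv v).inv_mem hymem), hΦ₀H,
        map_conj_of_mem hymem]
    · rw [hfst, map_mulAut_mul, map_mulAut_mul, hK₁₀, ← map_mulAut_mul _ _ (Rc.Hb b₀), ← map_mul,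
        inv_mul_cancel, map_one]
      have h1 : (Rc.Hb b₀).map (1 : MulAut c.G).toMonoidHom = Rc.Hb b₀ := by ext z; simp
      rw [h1, hΦ₀K]
  · /- different classes: `T_{c₁''} · T_{c₀} = P`; ONE lift stabilises all three; clause (A) at `g = 1` -/
    have hu : IsUnit (w p q.s * coeff p β₁ - (p : ℤ_[p]) * q.a - coeff p β₀) :=
      isUnit_conj_label_sub hc q
    refine (hest ((loopGraph p).graph.edgeOf b₀) b₀ rfl v hb₀ 1 (Subgroup.one_mem _)).1 b₁ hb₁ hne.symm
      (isArithAmple_of_forall_exists _ fun a => ?_)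
    obtain ⟨Φ₀, hmk₀, hΦ₀H, hΦ₀K⟩ :=
      exists_stabilizing_lift p c ρ' baseAct hBR noSwitchBase a β₀ v hβ₀ χ₀ hχ₀
    obtain ⟨Φ₁, hmk₁, hΦ₁H, hΦ₁K⟩ :=
      exists_stabilizing_lift p c ρ' baseAct hBR noSwitchBase a β₁ v hβ₁ χ₁ hχ₁
    rw [← hKχ₀] at hΦ₀K
    rw [← hHχ₀] at hΦ₀H
    rw [← hKχ₁] at hΦ₁K
    rw [← hHχ₁] at hΦ₁H
    -- the two lifts differ by `γ_{χ₀ q'}`, `q' ∈ P = T_{c₁''} · T_{c₀}`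
    obtain ⟨g', hg'H, hg'⟩ :=
      exists_mem_coe_eq_conj_mul h37 c hHv Φ₀ Φ₁ (hmk₀.trans hmk₁.symm) hΦ₀H hΦ₁H
    rw [hHχ₀] at hg'H
    obtain ⟨q', rfl⟩ := hg'H
    obtain ⟨t, ht, t', ht', hq'⟩ := Iw.exists_mul_eq_of_isUnit_sub hu q'
    have hmul : χ₀.toMonoidHom q' = χ₀.toMonoidHom t * χ₀.toMonoidHom t' := by
      rw [hq']; exact map_mul χ₀.toMonoidHom t t'
    have htK : χ₀.toMonoidHom t ∈ Rc.Hb b₁ := by rw [hKχ₁']; exact ⟨t, ht, rfl⟩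
    have ht'K : χ₀.toMonoidHom t' ∈ Rc.Hb b₀ := by rw [hKχ₀]; exact ⟨t', ht', rfl⟩
    have ht'H : χ₀.toMonoidHom t' ∈ Rc.Hv v := by rw [hHχ₀]; exact ⟨t', rfl⟩
    -- the re-aligned lift `Φ := γ_{χ₀ t'} ∘ Φ₀ = γ_{χ₀ t}⁻¹ ∘ Φ₁`
    let Φ : contMulAut c.G := (toOuterSemidirectProduct ρ' (χ₀.toMonoidHom t')).1.1 * Φ₀
    have hΦcoe : (Φ : MulAut c.G) = MulAut.conj (χ₀.toMonoidHom t') * (Φ₀ : MulAut c.G) := rfl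
    have hΦcoe' : (Φ : MulAut c.G) = MulAut.conj (χ₀.toMonoidHom t)⁻¹ * (Φ₁ : MulAut c.G) := by
      rw [hΦcoe, hg', hmul, map_mul, map_inv, ← mul_assoc, ← mul_assoc, inv_mul_cancel, one_mul]
    have hmk : TopOut.mk c.G Φ = ρ' a := by
      change TopOut.mk c.G ((toOuterSemidirectProduct ρ' (χ₀.toMonoidHom t')).1.1 * Φ₀) = ρ' a
      rw [map_mul, mk_fst_toOuterSemidirectProduct, one_mul, hmk₀]
    let γ : outerSemidirectProduct ρ' := ⟨(Φ, a), hmk⟩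
    have hγH : (Rc.Hv v).map ((γ : contMulAut c.G × PA).1 : MulAut c.G).toMonoidHom = Rc.Hv v := by
      change (Rc.Hv v).map (Φ : MulAut c.G).toMonoidHom = Rc.Hv v
      rw [hΦcoe, map_mulAut_mul, hΦ₀H, map_conj_of_mem ht'H]
    have hγ₀ : γ ∈ arithBrGp Rc (toOuterSemidirectProduct ρ') b₀ := by
      refine mem_arithBrGp_of_map_eq c ρ' Rc γ hb₀ hγH ?_
      change (Rc.Hb b₀).map (Φ : MulAut c.G).toMonoidHom = Rc.Hb b₀
      rw [hΦcoe, map_mulAut_mul, hΦ₀K, map_conj_of_mem ht'K]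
    have hγ₁ : γ ∈ arithBrGp Rc (toOuterSemidirectProduct ρ') b₁ := by
      refine mem_arithBrGp_of_map_eq c ρ' Rc γ hb₁ hγH ?_
      change (Rc.Hb b₁).map (Φ : MulAut c.G).toMonoidHom = Rc.Hb b₁
      rw [hΦcoe', map_mulAut_mul, hΦ₁K, map_conj_of_mem ((Rc.Hb b₁).inv_mem htK)]
    refine ⟨γ, Subgroup.mem_inf.mpr ⟨hγ₀, ?_⟩, rfl⟩
    exact ⟨γ, hγ₁, by rw [MulEquiv.coe_toMonoidHom, MulAut.conj_apply]; group⟩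

end BranchTransport

end IwahoriWitness

end Literature.AnabelianGeometry.SemiGraphs
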